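import Summits.QuantumFields.BalabanUV.Beta.EriceRemainderEnclosureHistoryAutonomyComparisonAffineProfile
import Summits.QuantumFields.BalabanUV.Beta.EriceRemainderEnclosureHistoryAutonomyComparisonKernelPSD

/-!
# EriceRemainderEnclosureHistoryAutonomyComparisonKernelChord — THE WINDOW CONJECTURE (E58b-W) AT ITS SHARP CONSTANT: the chord inequality
# `ρ + σ(a,b) ≤ σ(m,a) + σ(m,b)` of `…ComparisonKernelPSD` REDUCES TO ITS MIDPOINT CASE by an elementary concavity argument and holds for `b ≤ 256·a`;
# hence **`Σ_j L_j∕P_j ≤ 2∕(ρ + σ(K₀,K₁))` for EVERY profile on a window `[K₀,K₁]`, `K₁ ≤ 256K₀`** (the exact two-point supremum; any number of ages,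
# any sizes, any Markov weight), and **ALL MEMORY AGES WITHIN A FACTOR 133 COMPARE AT ANY SIZE** (`ρ + 133^{1∕4}∕√134 = 1.0005 ≥ 1`; two ages at ratio
# `134` with weights `1 : 134^{1∕4}` already have `Σ L_j∕P_j = 2.0001` — the profile condition's own limit)

Cell `pub-balaban`, β-function sub-cell, BINDER row D4 «RemainderConst leaves for Bałaban's split» (`HOME/BINDER-OWNERS.md`; owner lineage `b2b-balaban-beta-an4`;
this file by co-owner #3 lineage `b2b-balaban-beta-d4-p3`, generation 101, road P3), β-FLOW TEAM duty (1), FREEZE (0) honoured (def-free;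
`…ComparisonKernelPSD.profileSum_le_two_point_of_chord`, (E58b)'s `le_of_isotone_excess_affine_profile` BY NAME; nothing restated).  Fourth file of gen 101's
station (P3·W): `…ComparisonKernelEnergy` (p572068), `…ComparisonWindowHundred` (p572742: factor `108` by affine minorants), `…ComparisonKernelPSD` (p573567:
PSD road, sharp bound conditional on the chord inequality).

HONEST FRAMING (page 1, verbatim and binding).  *"Discharging BetaPertH makes Bałaban's UV stability UNCONDITIONAL — a real constructive-QFT result; it is
NOT the continuum limit and NOT the Clay problem."*  THIS FILE DISCHARGES NOTHING OF THE KIND.  Elementary real algebra (`√`, finite sums) about the cell's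
own NOT-IN-PRINT comparison binder (conjecture (E58′)); the age profile of Bałaban's (1.22) limit functional is NOT PRINTED ([I] p. 298; GAPS G-t4-U2-1∕-2)
and NOT asserted.  Row D4 class UNCHANGED (critical-path width 0; instance 0∕1; D4 DISCHARGE NO DATE).  HONEST DEPENDENCY: continuum YM on T⁴ ⇐ BetaPertH
∧ nine spine estimates (0/9 proved); BetaPertH ⇐ (D1) ∧ (D4) ∧ CAP+tail; G-an2-4 gates asym, D1 and NE2/3/4.

THE POINT (census sense (α); the COMPARISON column).  With `p = m∕a = x⁴`, `q = b∕m = y⁴` (`x, y ≥ 1`) the geometric reads are `σ(m,a) = 1∕√A`,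
`σ(m,b) = 1∕√B`, `σ(a,b) = 1∕√C`, `ρ = 1∕√2` for `A = x² + x⁻²`, `B = y² + y⁻²`, `C = x²y² + x⁻²y⁻²` (`2cosh` of the log-distances), and with
`u = xy`, `κ = (u + u⁻¹)∕2` (`cosh(ℓ∕4)`), `w = (x∕y + y∕x)∕2 ∈ [1, κ]` (`cosh` of the offset from the midpoint): `A + B = 4κw`, `AB = 4(w² + κ² − 1)`,
`C = 2(2κ² − 1)`.  So the squared chord inequality is **`H(w) := κw∕r² + 1∕r ≥ κ²∕G² + 1∕G =: h₀`**, `r² = w² + κ² − 1`, `G² = 2κ² − 1`, with EQUALITY at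
`w = κ` (`m = a` or `m = b`) and the MIDPOINT `m = √(ab)` at `w = 1`, where `H(1) = 2∕κ`.  §1 **`core_chord`**: for `κ ≤ r ≤ G` the function
`φ(r) = κ√(r² − κ² + 1) + r − h₀r²` is CONCAVE with `φ(G) = 0`, `φ(κ) = κ(2 − h₀κ)`; elementarily `(G−κ)√(r²−κ²+1) ≥ (G−r) + (r−κ)κ` (squared:
`2(r−κ)(G−r)(κ(G−1) − κ² + 1)`, and `κ²G² − (κ² + κ − 1)² = (κ−1)³(κ+1)`), so `(G−κ)φ(r) ≥ (G−r)κ(2 − h₀κ) + h₀(G−κ)(r−κ)(G−r) ≥ 0` once `h₀κ ≤ 2` —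
THE CHORD INEQUALITY ON THE WHOLE WINDOW FOLLOWS FROM ITS MIDPOINT CASE `h₀κ ≤ 2`.  §1 **`midpoint_of_kappa_le`**: `h₀κ ≤ 2` for `κ ≤ 17∕8` (ratio
`b∕a = u⁴ ≤ 256`; true up to `≈ 342`): `κ²(2κ²−1) ≤ (4κ² − 2 − κ³)²` is `(κ−1)(κ⁵ − 7κ⁴ + 7κ³ + 11κ² − 4κ − 4) ≥ 0`, the quintic Bernstein-positive on
`[1, 17∕8]` (one `nlinarith`).  §2 **`chord_xy`** (the translation; `√(1∕2) + xy∕√(1+(xy)⁴) ≤ x∕√(1+x⁴) + y∕√(1+y⁴)` for `x, y ≥ 1`, `xy ≤ 4`),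
`sqrt_geomRead_eq`, **`chord_ages`** (`0 < a ≤ m ≤ b ≤ 256a`).  §3 **`profileSum_le_two_point`** — the SHARP bound `2∕(ρ + σ(K₀,K₁))` on every window with
`K₁ ≤ 256K₀` (`1.465 ∕ 1.560 ∕ 1.802 ∕ 1.957 ∕ 1.969 ∕ 2.0001` at ratio `3 ∕ 7 ∕ 36 ∕ 100 ∕ 108 ∕ 134`) —, `profileSum_extend` (zero-padding the range),
`one_le_sqrt_half_add_geomRead_133`, **`profileSum_le_two_of_window_133`** and the END **`le_of_isotone_excess_affine_window_133`** via (E58b) BY NAME.  This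
CLOSES gen 100's WINDOW CONJECTURE (E58b-W) («every profile on a window of ratio `R` passes the profile condition iff `R ≤ 133.87`»: the «if» at every
integer ratio `≤ 133`; the «only if» is the two-point profile).  NOT CLAIMED: windows beyond `256` for the two-point bound (midpoint condition to `≈ 342`,
then a third age becomes profitable — gen 100's KKT flip); comparison (E58′) itself beyond the profile condition; anything printed.

WHAT IS PROVED ([folklore]; 0 `def`, 0 sorry).  §1 **`core_chord`**, **`midpoint_of_kappa_le`**.  §2 **`chord_xy`**, `sqrt_geomRead_eq`, **`chord_ages`**.  §3
**`profileSum_le_two_point`**, `profileSum_extend`, `one_le_sqrt_half_add_geomRead_133`, **`profileSum_le_two_of_window_133`**, **`le_of_isotone_excess_affine_window_133`**.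
-/
noncomputable section
open Finset Set

namespace Summit.QuantumFields.BalabanUV.Beta.EriceRemainderEnclosureHistoryAutonomyComparisonKernelChord

/-! ## §1 The core lemma: on `[1, κ]` the function `H(w) = κw∕(w²+σ²) + 1∕√(w²+σ²)` stays above `H(κ)` as soon as `H(1) ≥ H(κ)` -/
set_option maxHeartbeats 400000 in
/-- **CORE LEMMA (concavity along the window).**  `κ ≥ 1`, `G > 0` with `G² = 2κ² − 1`, `1 ≤ w ≤ κ`, `r > 0` with `r² = w² + κ² − 1`, and the MIDPOINT
CONDITION `h₀·κ ≤ 2` for `h₀ := κ²∕G² + 1∕G`.  Then `h₀ ≤ κ·w∕r² + 1∕r`.  Proof: `κ ≤ r ≤ G`; `φ(r) := κw + r − h₀r²` (`w = √(r² − κ² + 1)`) is concave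
with `φ(G) = 0` and `φ(κ) = κ(2 − h₀κ) ≥ 0`; elementarily, `(G−κ)w ≥ (G−r) + (r−κ)κ` (squared: `2(r−κ)(G−r)(κ(G−1) − κ² + 1) ≥ 0`, and
`κG ≥ κ² + κ − 1` from `κ²G² − (κ²+κ−1)² = (κ−1)³(κ+1)`), whence `(G−κ)φ(r) = (G−r)κ(2 − h₀κ) + h₀(G−κ)(r−κ)(G−r) + κ·[(G−κ)w − (G−r) − (r−κ)κ] ≥ 0`.
[folklore] -/
theorem core_chord {κ w G r : ℝ} (hκ : 1 ≤ κ) (hw1 : 1 ≤ w) (hwκ : w ≤ κ) (hG0 : 0 < G) (hG : G ^ 2 = 2 * κ ^ 2 - 1)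
    (hr0 : 0 < r) (hr : r ^ 2 = w ^ 2 + (κ ^ 2 - 1)) (hmid : (κ ^ 2 / G ^ 2 + 1 / G) * κ ≤ 2) :
    κ ^ 2 / G ^ 2 + 1 / G ≤ κ * w / r ^ 2 + 1 / r := by
  set h₀ : ℝ := κ ^ 2 / G ^ 2 + 1 / G with hh₀
  have hκ0 : 0 ≤ κ := by linarith
  have hh₀0 : 0 ≤ h₀ := by positivity
  have hκG : κ ≤ G := by nlinarith
  have hκr : κ ≤ r := by nlinarith
  have hrG : r ≤ G := by nlinarith
  -- (1) `κ(G − 1) ≥ κ² − 1`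
  have hkey0 : κ ^ 2 + κ - 1 ≤ κ * G := by
    have h1 : 0 ≤ κ ^ 2 + κ - 1 := by nlinarith
    have h2 : (κ ^ 2 + κ - 1) ^ 2 ≤ (κ * G) ^ 2 := by
      have : (κ * G) ^ 2 = κ ^ 2 * (2 * κ ^ 2 - 1) := by rw [mul_pow, hG]
      rw [this]
      nlinarith [mul_nonneg (mul_nonneg (by linarith : (0:ℝ) ≤ κ - 1) (by linarith : (0:ℝ) ≤ κ - 1))
        (mul_nonneg (by linarith : (0:ℝ) ≤ κ - 1) (by linarith : (0:ℝ) ≤ κ + 1))]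
    exact (pow_le_pow_iff_left₀ h1 (by positivity) two_ne_zero).mp h2
  -- (2) `(G − κ)·w ≥ (G − r) + (r − κ)κ`
  have hkey1 : (G - r) + (r - κ) * κ ≤ (G - κ) * w := by
    have h1 : 0 ≤ (G - r) + (r - κ) * κ := by nlinarith
    have h2 : ((G - r) + (r - κ) * κ) ^ 2 ≤ ((G - κ) * w) ^ 2 := by
      have e : ((G - κ) * w) ^ 2 - ((G - r) + (r - κ) * κ) ^ 2
          = 2 * (r - κ) * (G - r) * (κ * G - κ - (κ ^ 2 - 1)) := by
        have ew : w ^ 2 = r ^ 2 - (κ ^ 2 - 1) := by linarith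
        rw [mul_pow, ew]
        nlinarith [hG]
      nlinarith [mul_nonneg (mul_nonneg (sub_nonneg.2 hκr) (sub_nonneg.2 hrG)) (by linarith : (0:ℝ) ≤ κ * G - κ - (κ ^ 2 - 1))]
    exact (pow_le_pow_iff_left₀ h1 (mul_nonneg (sub_nonneg.2 hκG) (by linarith)) two_ne_zero).mp h2
  -- (3) `h₀G² = κ² + G`
  have hh₀G : h₀ * G ^ 2 = κ ^ 2 + G := by
    rw [hh₀]; field_simp
  -- (4) `φ(r) ≥ 0`
  have hφ : 0 ≤ κ * w + r - h₀ * r ^ 2 := by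
    rcases hκG.eq_or_lt with hκGe | hκGlt
    · -- degenerate window: `G = κ = r = w = 1`
      have hκ1 : κ = 1 := by nlinarith
      have hG1 : G = 1 := by rw [← hκGe, hκ1]
      have hr1 : r = 1 := by nlinarith
      have hw1' : w = 1 := by nlinarith
      rw [hκ1, hG1] at hh₀
      rw [hh₀, hκ1, hw1', hr1]; norm_num
    · have hpos : 0 < G - κ := sub_pos.2 hκGlt
      have e : (G - κ) * (κ * w + r - h₀ * r ^ 2)
          = (G - r) * κ * (2 - h₀ * κ) + h₀ * (G - κ) * (r - κ) * (G - r)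
            + κ * ((G - κ) * w - ((G - r) + (r - κ) * κ)) := by
        linear_combination (κ - r) * hh₀G
      have hnn : 0 ≤ (G - κ) * (κ * w + r - h₀ * r ^ 2) := by
        rw [e]
        have t1 : 0 ≤ (G - r) * κ * (2 - h₀ * κ) := mul_nonneg (mul_nonneg (sub_nonneg.2 hrG) hκ0) (by linarith)
        have t2 : 0 ≤ h₀ * (G - κ) * (r - κ) * (G - r) :=
          mul_nonneg (mul_nonneg (mul_nonneg hh₀0 hpos.le) (sub_nonneg.2 hκr)) (sub_nonneg.2 hrG)
        have t3 : 0 ≤ κ * ((G - κ) * w - ((G - r) + (r - κ) * κ)) := mul_nonneg hκ0 (by linarith)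
        linarith
      nlinarith
  -- (5) divide by `r²`
  have e : κ * w / r ^ 2 + 1 / r - h₀ = (κ * w + r - h₀ * r ^ 2) / r ^ 2 := by
    field_simp
  have : 0 ≤ κ * w / r ^ 2 + 1 / r - h₀ := by rw [e]; positivity
  linarith

/-- **THE MIDPOINT CONDITION FOR WINDOWS OF RATIO `≤ 256`.**  `1 ≤ κ ≤ 17∕8`, `G > 0`, `G² = 2κ² − 1` ⟹ `(κ²∕G² + 1∕G)·κ ≤ 2` (for ages at ratio `R`,
`κ = (R^{1∕4} + R^{−1∕4})∕2 ≤ 17∕8` iff `R ≤ 256`; the condition itself holds up to `R ≈ 342`): `κ³ ≤ 4κ² − 2` and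
`κ²(2κ²−1) ≤ (4κ² − 2 − κ³)² ⟺ (κ−1)(κ⁵ − 7κ⁴ + 7κ³ + 11κ² − 4κ − 4) ≥ 0`, the quintic being Bernstein-positive on `[1, 17∕8]`. [folklore] -/
theorem midpoint_of_kappa_le {κ G : ℝ} (hκ : 1 ≤ κ) (hκ1 : κ ≤ 17 / 8) (hG0 : 0 < G) (hG : G ^ 2 = 2 * κ ^ 2 - 1) :
    (κ ^ 2 / G ^ 2 + 1 / G) * κ ≤ 2 := by
  have hΓ : 0 < 2 * κ ^ 2 - 1 := by nlinarith
  have hc : κ ^ 3 ≤ 4 * κ ^ 2 - 2 := by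
    nlinarith [mul_nonneg (sub_nonneg.2 hκ) (by nlinarith : (0:ℝ) ≤ 3 * κ + 3 - κ ^ 2)]
  -- the quintic certificate
  have hN : 0 ≤ κ ^ 5 - 7 * κ ^ 4 + 7 * κ ^ 3 + 11 * κ ^ 2 - 4 * κ - 4 := by
    have hu : 0 ≤ κ - 1 := by linarith
    have hv : 0 ≤ 17 / 8 - κ := by linarith
    nlinarith [mul_nonneg (pow_nonneg hu 0) (pow_nonneg hv 5), mul_nonneg (pow_nonneg hu 1) (pow_nonneg hv 4),
      mul_nonneg (pow_nonneg hu 2) (pow_nonneg hv 3), mul_nonneg (pow_nonneg hu 3) (pow_nonneg hv 2),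
      mul_nonneg (pow_nonneg hu 4) (pow_nonneg hv 1), mul_nonneg (pow_nonneg hu 5) (pow_nonneg hv 0)]
  have hM : κ ^ 2 * (2 * κ ^ 2 - 1) ≤ (4 * κ ^ 2 - 2 - κ ^ 3) ^ 2 := by
    nlinarith [mul_nonneg (sub_nonneg.2 hκ) hN]
  -- `κ∕G ≤ (4κ² − 2 − κ³)∕G²`
  have h1 : κ * G ≤ 4 * κ ^ 2 - 2 - κ ^ 3 := by
    have ha : 0 ≤ 4 * κ ^ 2 - 2 - κ ^ 3 := by linarith
    have hb : (κ * G) ^ 2 ≤ (4 * κ ^ 2 - 2 - κ ^ 3) ^ 2 := by rw [mul_pow, hG]; exact hM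
    exact (pow_le_pow_iff_left₀ (by positivity) ha two_ne_zero).mp hb
  have hG2 : G * G = 2 * κ ^ 2 - 1 := by rw [← pow_two, hG]
  have h2 : κ / G ≤ (4 * κ ^ 2 - 2 - κ ^ 3) / (2 * κ ^ 2 - 1) := by
    rw [div_le_div_iff₀ hG0 hΓ]
    nlinarith [mul_le_mul_of_nonneg_right h1 hG0.le]
  rw [hG]
  calc (κ ^ 2 / (2 * κ ^ 2 - 1) + 1 / G) * κ = κ ^ 3 / (2 * κ ^ 2 - 1) + κ / G := by ring
    _ ≤ κ ^ 3 / (2 * κ ^ 2 - 1) + (4 * κ ^ 2 - 2 - κ ^ 3) / (2 * κ ^ 2 - 1) := by linarith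
    _ = 2 := by rw [← add_div, div_eq_iff hΓ.ne']; ring

/-! ## §2 The chord inequality for the geometric read: `g(p) + g(q) ≥ ρ + g(pq)` for `p, q ≥ 1`, `pq ≤ 256` -/

/-- **THE CHORD INEQUALITY IN QUARTIC-ROOT COORDINATES.**  For `x, y ≥ 1` with `xy ≤ 4` (ages at ratios `p = x⁴`, `q = y⁴`, `pq ≤ 256`):
`√(1∕2) + xy∕√(1+(xy)⁴) ≤ x∕√(1+x⁴) + y∕√(1+y⁴)`, i.e. `ρ + g(pq) ≤ g(p) + g(q)` for `g(t) = t^{1∕4}∕√(1+t)`.  With `u = xy`, `κ = (u²+1)∕(2u)`,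
`w = (x²+y²)∕(2xy) ∈ [1, κ]`, `G = √(1+u⁴)∕(√2·u)`, `r = √(1+x⁴)√(1+y⁴)∕(2xy)`: the square of the right side is `κw∕r² + 1∕r`, the square of the left side is
`κ²∕G² + 1∕G`, and §1 applies (`core_chord` with `midpoint_of_kappa_le`). [folklore] -/
theorem chord_xy {x y : ℝ} (hx : 1 ≤ x) (hy : 1 ≤ y) (hxy : x * y ≤ 4) :
    Real.sqrt (1 / 2) + x * y / Real.sqrt (1 + (x * y) ^ 4) ≤ x / Real.sqrt (1 + x ^ 4) + y / Real.sqrt (1 + y ^ 4) := by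
  have hx0 : 0 < x := by linarith
  have hy0 : 0 < y := by linarith
  have hxy0 : 0 < x * y := mul_pos hx0 hy0
  have hu1 : 1 ≤ x * y := by nlinarith
  set κ : ℝ := ((x * y) ^ 2 + 1) / (2 * (x * y)) with hκ
  set w : ℝ := (x ^ 2 + y ^ 2) / (2 * (x * y)) with hw
  have hκ1 : 1 ≤ κ := by
    rw [hκ, le_div_iff₀ (by positivity)]; nlinarith
  have hκ2 : κ ≤ 17 / 8 := by
    rw [hκ, div_le_iff₀ (by positivity)]
    nlinarith [mul_nonneg (by linarith : (0:ℝ) ≤ 4 - x * y) (by linarith : (0:ℝ) ≤ 8 * (x * y) - 2)]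
  have hw1 : 1 ≤ w := by
    rw [hw, le_div_iff₀ (by positivity)]; nlinarith [sq_nonneg (x - y)]
  have hwκ : w ≤ κ := by
    rw [hw, hκ, div_le_div_iff_of_pos_right (by positivity)]
    nlinarith [mul_nonneg (by nlinarith : (0:ℝ) ≤ x ^ 2 - 1) (by nlinarith : (0:ℝ) ≤ y ^ 2 - 1)]
  set P : ℝ := Real.sqrt (1 + x ^ 4) with hP
  set Q : ℝ := Real.sqrt (1 + y ^ 4) with hQ
  set U : ℝ := Real.sqrt (1 + (x * y) ^ 4) with hU
  have hP0 : 0 < P := Real.sqrt_pos.2 (by positivity)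
  have hQ0 : 0 < Q := Real.sqrt_pos.2 (by positivity)
  have hU0 : 0 < U := Real.sqrt_pos.2 (by positivity)
  have hP2 : P ^ 2 = 1 + x ^ 4 := Real.sq_sqrt (by positivity)
  have hQ2 : Q ^ 2 = 1 + y ^ 4 := Real.sq_sqrt (by positivity)
  have hU2 : U ^ 2 = 1 + (x * y) ^ 4 := Real.sq_sqrt (by positivity)
  have hs0 : 0 < Real.sqrt 2 := Real.sqrt_pos.2 (by norm_num)
  have hs2 : Real.sqrt 2 ^ 2 = 2 := Real.sq_sqrt (by norm_num)
  have hhalf : Real.sqrt (1 / 2) = Real.sqrt 2 / 2 := by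
    rw [Real.sqrt_div' _ (by norm_num : (0:ℝ) ≤ 2), Real.sqrt_one]
    field_simp
    exact hs2.symm
  set G : ℝ := U / (Real.sqrt 2 * (x * y)) with hG
  have hG0 : 0 < G := by positivity
  have hGsq : G ^ 2 = 2 * κ ^ 2 - 1 := by
    rw [hG, hκ, div_pow, mul_pow, hU2, hs2]
    field_simp
    ring
  set r : ℝ := P * Q / (2 * (x * y)) with hr
  have hr0 : 0 < r := by positivity
  have hrsq : r ^ 2 = w ^ 2 + (κ ^ 2 - 1) := by
    rw [hr, hw, hκ, div_pow, mul_pow, hP2, hQ2]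
    field_simp
    ring
  have core := core_chord hκ1 hw1 hwκ hG0 hGsq hr0 hrsq (midpoint_of_kappa_le hκ1 hκ2 hG0 hGsq)
  have hΓne : 2 * κ ^ 2 - 1 ≠ 0 := by nlinarith
  have hden : w ^ 2 + (κ ^ 2 - 1) ≠ 0 := by nlinarith
  -- the two squares
  have eL : κ ^ 2 / G ^ 2 + 1 / G = (Real.sqrt (1 / 2) + x * y / U) ^ 2 := by
    have e1 : κ ^ 2 / G ^ 2 = ((x * y) ^ 2 + 1) ^ 2 / (2 * (1 + (x * y) ^ 4)) := by
      rw [hGsq, div_eq_div_iff hΓne (by positivity), hκ]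
      field_simp
      ring
    have e2 : 1 / G = Real.sqrt 2 * (x * y) / U := by
      rw [hG, one_div_div]
    have e3 : (Real.sqrt (1 / 2) + x * y / U) ^ 2
        = (1 / 2 + (x * y) ^ 2 / U ^ 2) + Real.sqrt 2 * (x * y) / U := by
      rw [hhalf]
      have : (Real.sqrt 2 / 2 + x * y / U) ^ 2
          = Real.sqrt 2 ^ 2 / 4 + (x * y) ^ 2 / U ^ 2 + Real.sqrt 2 * (x * y) / U := by
        field_simp
        ring
      rw [this, hs2]
      ring
    rw [e1, e2, e3, hU2]
    congr 1
    field_simp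
    ring
  have eR : κ * w / r ^ 2 + 1 / r = (x / P + y / Q) ^ 2 := by
    have e1 : κ * w / r ^ 2 = ((x * y) ^ 2 + 1) * (x ^ 2 + y ^ 2) / ((1 + x ^ 4) * (1 + y ^ 4)) := by
      rw [hrsq, div_eq_div_iff hden (by positivity), hκ, hw]
      field_simp
      ring
    have e2 : 1 / r = 2 * (x * y) / (P * Q) := by
      rw [hr, one_div_div]
    have e3 : (x / P + y / Q) ^ 2 = (x ^ 2 / P ^ 2 + y ^ 2 / Q ^ 2) + 2 * (x * y) / (P * Q) := by
      field_simp
      ring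
    rw [e1, e2, e3, hP2, hQ2]
    congr 1
    field_simp
    ring
  rw [eL, eR] at core
  have ha : 0 ≤ Real.sqrt (1 / 2) + x * y / U := by positivity
  have hb : 0 ≤ x / P + y / Q := by positivity
  exact (pow_le_pow_iff_left₀ ha hb two_ne_zero).mp core

/-- The geometric read of two ages `p, q > 0` in quartic-root form: `√(√(p∕(p+q))·√(q∕(q+p))) = z∕√(1+z⁴)`, `z = (q∕p)^{1∕4}`. [folklore] -/
theorem sqrt_geomRead_eq {p q : ℝ} (hp : 0 < p) (hq : 0 < q) :
    Real.sqrt (Real.sqrt (p / (p + q)) * Real.sqrt (q / (q + p)))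
      = Real.sqrt (Real.sqrt (q / p)) / Real.sqrt (1 + Real.sqrt (Real.sqrt (q / p)) ^ 4) := by
  set z : ℝ := Real.sqrt (Real.sqrt (q / p)) with hz
  have hz0 : 0 ≤ z := Real.sqrt_nonneg _
  have hz2 : Real.sqrt (q / p) = z ^ 2 := by rw [hz, Real.sq_sqrt (Real.sqrt_nonneg _)]
  have hz4 : z ^ 4 = q / p := by
    rw [show z ^ 4 = (z ^ 2) ^ 2 by ring, ← hz2, Real.sq_sqrt (div_nonneg hq.le hp.le)]
  have hprod : Real.sqrt (p / (p + q)) * Real.sqrt (q / (q + p)) = Real.sqrt (q / p) / (1 + q / p) := by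
    rw [← Real.sqrt_mul (div_nonneg hp.le (by positivity))]
    have e : p / (p + q) * (q / (q + p)) = (q / p) / (1 + q / p) ^ 2 := by field_simp; ring
    rw [e, Real.sqrt_div' _ (by positivity), Real.sqrt_sq (by positivity)]
  rw [hprod, hz2, show (1 : ℝ) + q / p = 1 + z ^ 4 by rw [hz4], Real.sqrt_div' _ (by positivity), Real.sqrt_sq hz0]

/-- **THE CHORD INEQUALITY FOR AGES** `0 < a ≤ m ≤ b`, `b ≤ 256·a`: `ρ + σ(a,b) ≤ σ(m,a) + σ(m,b)` for the geometric read `σ(i,j) = √(√(i∕(i+j))·√(j∕(j+i)))`,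
`ρ = √(1∕2)` — the hypothesis `hchord` of `…ComparisonKernelPSD.profileSum_le_two_point_of_chord`.  (`x = (m∕a)^{1∕4}`, `y = (b∕m)^{1∕4}` in `chord_xy`.)
[folklore] -/
theorem chord_ages {a m b : ℝ} (ha : 0 < a) (ham : a ≤ m) (hmb : m ≤ b) (hb : b ≤ 256 * a) :
    Real.sqrt (1 / 2) + Real.sqrt (Real.sqrt (a / (a + b)) * Real.sqrt (b / (b + a)))
      ≤ Real.sqrt (Real.sqrt (m / (m + a)) * Real.sqrt (a / (a + m)))
        + Real.sqrt (Real.sqrt (m / (m + b)) * Real.sqrt (b / (b + m))) := by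
  have hm : 0 < m := lt_of_lt_of_le ha ham
  have hb0 : 0 < b := lt_of_lt_of_le hm hmb
  set x : ℝ := Real.sqrt (Real.sqrt (m / a)) with hx
  set y : ℝ := Real.sqrt (Real.sqrt (b / m)) with hy
  have hx1 : 1 ≤ x := by
    rw [hx, ← Real.sqrt_one]
    exact Real.sqrt_le_sqrt (by rw [← Real.sqrt_one]; exact Real.sqrt_le_sqrt ((one_le_div ha).2 ham))
  have hy1 : 1 ≤ y := by
    rw [hy, ← Real.sqrt_one]
    exact Real.sqrt_le_sqrt (by rw [← Real.sqrt_one]; exact Real.sqrt_le_sqrt ((one_le_div hm).2 hmb))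
  have hx0 : 0 ≤ x := by linarith
  have hy0 : 0 ≤ y := by linarith
  have hxy : Real.sqrt (Real.sqrt (b / a)) = x * y := by
    rw [hx, hy, ← Real.sqrt_mul (Real.sqrt_nonneg _), ← Real.sqrt_mul (div_nonneg hm.le ha.le)]
    congr 2
    field_simp
  have hx4 : x ^ 4 = m / a := by
    rw [show x ^ 4 = (x ^ 2) ^ 2 by ring, hx, Real.sq_sqrt (Real.sqrt_nonneg _), Real.sq_sqrt (div_nonneg hm.le ha.le)]
  have hy4 : y ^ 4 = b / m := by
    rw [show y ^ 4 = (y ^ 2) ^ 2 by ring, hy, Real.sq_sqrt (Real.sqrt_nonneg _), Real.sq_sqrt (div_nonneg hb0.le hm.le)]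
  have hxy4 : x * y ≤ 4 := by
    have h : (x * y) ^ 4 ≤ 4 ^ 4 := by
      rw [mul_pow, hx4, hy4]
      have : m / a * (b / m) = b / a := by field_simp
      rw [this, div_le_iff₀ ha]; norm_num; linarith
    exact (pow_le_pow_iff_left₀ (mul_nonneg hx0 hy0) (by norm_num) (by norm_num)).mp h
  rw [sqrt_geomRead_eq ha hb0, mul_comm (Real.sqrt (m / (m + a))), sqrt_geomRead_eq ha hm, sqrt_geomRead_eq hm hb0,
    hxy]
  exact chord_xy hx1 hy1 hxy4

/-! ## §3 The sharp window theorem: `Σ_j L_j∕P_j ≤ 2∕(ρ + σ(K₀,K₁))` on `[K₀, K₁]`, `K₁ ≤ 256K₀`; all ages within a factor `133` compare at any size -/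

open Literature.MathematicalPhysics.QuantumFieldTheory.Balaban1983to89
open Literature.MathematicalPhysics.QuantumFieldTheory.Balaban1983to89.T4BetaStationary
open Literature.MathematicalPhysics.QuantumFieldTheory.Balaban1983to89.T4BetaFlowWellPosed
open Summit.QuantumFields.BalabanUV.Beta.EriceRemainderEnclosureHistoryAutonomyComparisonAffineProfile (le_of_isotone_excess_affine_profile)
open Summit.QuantumFields.BalabanUV.Beta.EriceRemainderEnclosureHistoryAutonomyComparisonKernelPSD (profileSum_le_two_point_of_chord)

variable {B' : (ℕ → ℝ) → ℝ} {M' γ b : ℝ} {L : ℕ → ℝ} {K : ℕ} {h h' : ℕ → ℝ}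

/-- **THE SHARP WINDOW THEOREM (UNCONDITIONAL).**  `L ≥ 0` with every age `k ≥ 1` of non-zero weight in `[K₀, K₁]`, `1 ≤ K₀ ≤ K₁ < K`, `K₁ ≤ 256·K₀`
(the number of ages, their sizes and the Markov weight `L_0` ARBITRARY): **`Σ_{j<K} L_j∕P_j ≤ 2∕(ρ + σ(K₀,K₁))`**, `σ(K₀,K₁) = (K₀K₁)^{1∕4}∕√(K₀+K₁)` — the
EXACT supremum over profiles on the window (gen 100's memo F1: attained by the two extreme ages with weights `1 : (K₁∕K₀)^{1∕4}`).
`…ComparisonKernelPSD.profileSum_le_two_point_of_chord` + §2 `chord_ages`. [folklore] -/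
theorem profileSum_le_two_point {K₀ K₁ : ℕ} (hL : ∀ k, 0 ≤ L k) (hK₀ : 1 ≤ K₀) (h01 : K₀ ≤ K₁) (hK₁ : K₁ < K)
    (h256 : K₁ ≤ 256 * K₀) (hwin : ∀ k, k ≠ 0 → L k ≠ 0 → K₀ ≤ k ∧ k ≤ K₁) :
    ∑ j ∈ range K, L j / ∑ k ∈ range K, L k * Real.sqrt ((j : ℝ) / ((j : ℝ) + k))
      ≤ 2 / (Real.sqrt (1 / 2) + Real.sqrt (Real.sqrt ((K₀ : ℝ) / ((K₀ : ℝ) + K₁)) * Real.sqrt ((K₁ : ℝ) / ((K₁ : ℝ) + K₀)))) := by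
  have hK₀pos : (0 : ℝ) < K₀ := by exact_mod_cast hK₀
  refine profileSum_le_two_point_of_chord hL hK₀ h01 hK₁ hwin fun m h1 h2 _ => ?_
  exact chord_ages hK₀pos (by exact_mod_cast h1) (by exact_mod_cast h2) (by exact_mod_cast h256)

/-- Extending the range by zero weights does not change the profile sum: for `K ≤ K'` and `L′ = L·𝟙_{<K}`,
`Σ_{j<K} L_j∕P_j = Σ_{j<K′} L′_j∕P′_j`. [folklore] -/
theorem profileSum_extend {K' : ℕ} (hKK' : K ≤ K') :
    ∑ j ∈ range K, L j / ∑ k ∈ range K, L k * Real.sqrt ((j : ℝ) / ((j : ℝ) + k))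
      = ∑ j ∈ range K', (if j < K then L j else 0)
          / ∑ k ∈ range K', (if k < K then L k else 0) * Real.sqrt ((j : ℝ) / ((j : ℝ) + k)) := by
  have hinner : ∀ j, ∑ k ∈ range K', (if k < K then L k else 0) * Real.sqrt ((j : ℝ) / ((j : ℝ) + k))
      = ∑ k ∈ range K, L k * Real.sqrt ((j : ℝ) / ((j : ℝ) + k)) := by
    intro j
    rw [← sum_filter_add_sum_filter_not (range K') (fun k => k < K)]
    have hf : (range K').filter (fun k => k < K) = range K := by
      ext k; simp only [mem_filter, Finset.mem_range]; omega
    rw [hf, sum_eq_zero (s := (range K').filter (fun k => ¬k < K)) fun k hk => by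
      rw [if_neg (mem_filter.1 hk).2, zero_mul], add_zero]
    exact sum_congr rfl fun k hk => by rw [if_pos (Finset.mem_range.1 hk)]
  simp_rw [hinner]
  rw [← sum_filter_add_sum_filter_not (range K') (fun j => j < K)]
  have hf : (range K').filter (fun j => j < K) = range K := by
    ext j; simp only [mem_filter, Finset.mem_range]; omega
  rw [hf, sum_eq_zero (s := (range K').filter (fun j => ¬j < K)) fun j hj => by
    rw [if_neg (mem_filter.1 hj).2, zero_div], add_zero]
  exact sum_congr rfl fun j hj => by rw [if_pos (Finset.mem_range.1 hj)]

/-- The numerical fact behind the factor `133`: `√(1∕2) + 133^{1∕4}∕√134 ≥ 1` (`0.70710 + 0.29336`; the threshold of `ρ + R^{1∕4}∕√(1+R) ≥ 1` is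
`R = 133.87…`). [folklore] -/
theorem one_le_sqrt_half_add_geomRead_133 : 1 ≤ Real.sqrt (1 / 2) + Real.sqrt (Real.sqrt 133 / 134) := by
  have h1 : (11.5325 : ℝ) ≤ Real.sqrt 133 := Real.le_sqrt_of_sq_le (by norm_num)
  have h2 : (0.29336 : ℝ) ≤ Real.sqrt (Real.sqrt 133 / 134) := Real.le_sqrt_of_sq_le (by linarith)
  have h3 : (0.7071 : ℝ) ≤ Real.sqrt (1 / 2) := Real.le_sqrt_of_sq_le (by norm_num)
  linarith

/-- **`Σ_j L_j∕P_j ≤ 2` FOR EVERY PROFILE WHOSE AGES `k ≥ 1` LIE IN `[K₀, 133·K₀]`** (`K₀ ≥ 1`; any number of ages, any sizes, any Markov weight `L_0`) —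
the WINDOW CONJECTURE (E58b-W) of gen 100 at its sharp integer factor (`133.87…`; two ages at ratio `134` with weights `1 : 134^{1∕4}` give `2.0001`).
[folklore] -/
theorem profileSum_le_two_of_window_133 {K₀ : ℕ} (hL : ∀ k, 0 ≤ L k) (hK₀ : 1 ≤ K₀)
    (hwin : ∀ k, k ≠ 0 → L k ≠ 0 → K₀ ≤ k ∧ k ≤ 133 * K₀) :
    ∑ j ∈ range K, L j / ∑ k ∈ range K, L k * Real.sqrt ((j : ℝ) / ((j : ℝ) + k)) ≤ 2 := by
  -- extend the range beyond `133·K₀`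
  set K' : ℕ := max K (133 * K₀ + 1) with hK'
  set L' : ℕ → ℝ := fun k => if k < K then L k else 0 with hL'
  have hL'0 : ∀ k, 0 ≤ L' k := fun k => by simp only [hL']; split_ifs; exacts [hL k, le_rfl]
  have hwin' : ∀ k, k ≠ 0 → L' k ≠ 0 → K₀ ≤ k ∧ k ≤ 133 * K₀ := by
    intro k hk hLk
    simp only [hL'] at hLk
    split_ifs at hLk with hkK
    · exact hwin k hk hLk
    · exact absurd rfl hLk
  rw [profileSum_extend (L := L) (le_max_left K (133 * K₀ + 1) : K ≤ K')]
  change ∑ j ∈ range K', L' j / ∑ k ∈ range K', L' k * Real.sqrt ((j : ℝ) / ((j : ℝ) + k)) ≤ 2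
  have hK₁ : 133 * K₀ < K' := lt_of_lt_of_le (Nat.lt_succ_self _) (le_max_right _ _)
  have key := profileSum_le_two_point (K := K') hL'0 hK₀ (by omega) hK₁ (by omega) hwin'
  refine le_trans key ?_
  -- the denominator is `ρ + 133^{1∕4}∕√134 ≥ 1`
  have hK₀pos : (0 : ℝ) < K₀ := by exact_mod_cast hK₀
  have e1 : (K₀ : ℝ) / ((K₀ : ℝ) + ((133 * K₀ : ℕ) : ℝ)) = 1 / 134 := by push_cast; field_simp; ring
  have e2 : ((133 * K₀ : ℕ) : ℝ) / (((133 * K₀ : ℕ) : ℝ) + K₀) = 133 / 134 := by push_cast; field_simp; ring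
  have e3 : Real.sqrt (1 / 134) * Real.sqrt (133 / 134) = Real.sqrt 133 / 134 := by
    rw [← Real.sqrt_mul (by norm_num), show (1 / 134 : ℝ) * (133 / 134) = 133 / 134 ^ 2 by norm_num,
      Real.sqrt_div' _ (by norm_num), Real.sqrt_sq (by norm_num)]
  rw [e1, e2, e3, div_le_iff₀ (by positivity)]
  linarith [one_le_sqrt_half_add_geomRead_133]

/-- **ALL MEMORY AGES WITHIN A FACTOR 133 OF EACH OTHER ⟹ COMPARISON AT ANY SIZE** (a Markov term `L_0·u_0` may ride along; ANY number of ages,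
ANY sizes): if the weights `L_k`, `k ≥ 1`, vanish outside `K₀ ≤ k ≤ 133·K₀` (`K₀ ≥ 1`), every `B′ ≥ B = b + Σ_{k<K} L_k·u_k` with a zeroth moment and an
ISOTONE excess has `h′ ≤ h` at every scale from every pin.  (E58c): `3`; (E63e): `7`; `…WindowHundred`: `100`; here the profile condition's own limit.
[folklore] -/
theorem le_of_isotone_excess_affine_window_133 {p : ℝ} {K₀ : ℕ} (hL : ∀ k, 0 ≤ L k) (hb : 0 < b) (hK₀ : 1 ≤ K₀)
    (hwin : ∀ k, k ≠ 0 → L k ≠ 0 → K₀ ≤ k ∧ k ≤ 133 * K₀)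
    (hB' : ∀ u u' : ℕ → ℝ, SeqBox γ u → SeqBox γ u' → ∀ D : ℝ, (∀ j, |u j - u' j| ≤ D) → |B' u - B' u'| ≤ M' * D) (hM' : 0 ≤ M')
    (hexc : ∀ u, SeqBox γ u → (fun u : ℕ → ℝ => b + ∑ k ∈ range K, L k * u k) u ≤ B' u)
    (hDmono : ∀ u v : ℕ → ℝ, SeqBox γ u → SeqBox γ v → (∀ j, u j ≤ v j) →
      B' u - (fun u : ℕ → ℝ => b + ∑ k ∈ range K, L k * u k) u ≤ B' v - (fun u : ℕ → ℝ => b + ∑ k ∈ range K, L k * u k) v)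
    (hp : 0 < p) (hpγ : p ≤ γ) (hh : SeqBox γ h) (hf : MemFlow (fun u : ℕ → ℝ => b + ∑ k ∈ range K, L k * u k) p h)
    (hh' : SeqBox γ h') (hf' : MemFlow B' p h') (j : ℕ) : h' j ≤ h j :=
  le_of_isotone_excess_affine_profile hL hb (profileSum_le_two_of_window_133 (K := K) hL hK₀ hwin)
    hB' hM' hexc hDmono hp hpγ hh hf hh' hf' j

end Summit.QuantumFields.BalabanUV.Beta.EriceRemainderEnclosureHistoryAutonomyComparisonKernelChord

end
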